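import Mathlib
import Literature.Combinatorics.Additive.TPPGroupAlgebra
import Literature.Computability.AlgebraicComplexity.CohnUmansTPP
import Literature.Combinatorics.Enumerative.BregmanMinc
import Summits.MatrixMultiplication.MatrixMultiplication.Theorems.SnSubsetDichotomyGlobalBranchStubBregmanMinc
import Summits.MatrixMultiplication.MatrixMultiplication.Theorems.SnSubsetDichotomyGlobalBranchStubQuotientCard

/-!
# `SnSubsetDichotomy.GlobalBranch`, line `bregman-entropy-window` — the thin-quotient pre-filter (class-pruning theorem)

Crux `stmt-MatrixMultiplication-8303` (`…Theses.SnSubsetDichotomy.GlobalBranch`), line `bregman-entropy-window`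
(lead's skeleton `Cruxes/GlobalBranch/Lines/bregman_entropy_window.lean`, seat c1).  This file lands the
PROVABLE HALF of the line as theorems, assembled from the two landed stubs `stub_bregmanMinc` (Brégman–Minc in
set form, `log #X ≤ ∑_i log(r_i!)/r_i` with `r_i = #{σ i : σ ∈ X}`) and `stub_quotientCard`
(`#(S⁻¹T) = #S·#T` for a pairwise-injective pair):

* `log_card_mul_card_le_bregman_quot` — for a TPP triple with `U ≠ ∅`, `log #S + log #T` is at most the Brégman
  bound `∑_i log(r_i!)/r_i` of the QUOTIENT SET `S⁻¹T = image₂ (fun s t => s⁻¹ * t) S T`;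
* `two_mul_log_volume_le_of_tpp` — hence `2·log(#S #T #U) ≤ 2·log n! + (Brégman bound of S⁻¹T)` (the two other
  packing bounds `#T#U, #U#S ≤ n!`);
* `log_volume_le_of_tpp_of_bregman_set` — and `log(#S #T #U) ≤ log n! + (Brégman bound of S)`;
* `thinQuotient_subthreshold` — THE CLASS-PRUNING THEOREM: if the Brégman bound of the quotient set `S⁻¹T` is
  at most `log n! − 2c√n` (a "support-thin" quotient: its rows miss enough of `[n]`), then
  `#S #T #U ≤ (n!)^{3/2} e^{−c√n}` — for EVERY `c`, every `n`, no bump hypothesis; by `TripleProductProperty.rotate`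
  the same holds for `T⁻¹U` and `U⁻¹S`;
* `thinSet_subthreshold` — likewise if the Brégman bound of one SET is at most `½ log n! − c√n`.

What survives (the line's registered residual `stub_thickQuotientResidual`, crux-sized): bump-free TPP triples all
of whose quotient sets have Brégman bound within `2c√n` of `log n!` (thick row supports).
-/

set_option linter.dupNamespace false
set_option autoImplicit false

namespace Summit.MatrixMultiplication.MatrixMultiplication.Theorems.GlobalBranch

open scoped BigOperators Classical
open Finset
open Literature.Combinatorics.Additive

variable {n : ℕ}

/-- The TPP with a non-empty third set makes `(s,t) ↦ s⁻¹t` injective on `S × T` in the form consumed by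
`stub_quotientCard` (Cohn–Umans 2003, proof of Lemma 3.1). [cite: CohnUmans2003, Lemma 3.1] -/
theorem pairInj_of_tpp' {S T U : Finset (Equiv.Perm (Fin n))} (h : TripleProductProperty S T U)
    (hU : U.Nonempty) :
    ∀ s ∈ S, ∀ s' ∈ S, ∀ t ∈ T, ∀ t' ∈ T, s⁻¹ * t = s'⁻¹ * t' → s = s' ∧ t = t' := by
  obtain ⟨u, hu⟩ := hU
  intro s hs s' hs' t ht t' ht' he
  have key : s' * s⁻¹ * (t * t'⁻¹) * (u * u⁻¹) = 1 := by
    rw [mul_inv_cancel, mul_one, mul_assoc, ← mul_assoc s⁻¹, he]; group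
  obtain ⟨h1, h2, -⟩ := h s' hs' s hs t ht t' ht' u hu u hu key
  exact ⟨h1.symm, h2⟩

/-- Packing in logarithmic form: `log #S + log #T ≤ log n!` for a TPP triple of non-empty sets
(tree: `RealizesTPP.mul_le_card`). [cite: CohnUmans2003, Lemma 3.1] -/
theorem log_card_add_log_card_le_log_factorial {S T U : Finset (Equiv.Perm (Fin n))}
    (h : TripleProductProperty S T U) (hS : S.Nonempty) (hT : T.Nonempty) (hU : U.Nonempty) :
    Real.log (S.card : ℝ) + Real.log (T.card : ℝ) ≤ Real.log (n.factorial : ℝ) := by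
  have hreal : Literature.Computability.AlgebraicComplexity.RealizesTPP (Equiv.Perm (Fin n))
      S.card T.card U.card := ⟨S, T, U, rfl, rfl, rfl, h⟩
  have hle := hreal.mul_le_card (Finset.card_pos.2 hU).ne'
  have hle' : S.card * T.card ≤ n.factorial := by simpa [Fintype.card_perm, Fintype.card_fin] using hle
  have hSpos : (0 : ℝ) < S.card := by exact_mod_cast hS.card_pos
  have hTpos : (0 : ℝ) < T.card := by exact_mod_cast hT.card_pos
  rw [← Real.log_mul hSpos.ne' hTpos.ne']
  exact Real.log_le_log (by positivity) (by exact_mod_cast hle')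

/-- **Brégman bound of the quotient set dominates `#S·#T`.**  For a TPP triple with `U ≠ ∅` (so that
`(s,t) ↦ s⁻¹t` is injective on `S × T`), `log #S + log #T ≤ ∑_i log(r_i!)/r_i` where
`r_i = #{a i : a ∈ S⁻¹T}` are the row supports of the quotient set `S⁻¹T`: Brégman–Minc (`stub_bregmanMinc`)
applied to `S⁻¹T`, whose size is `#S·#T` (`stub_quotientCard`). [cite: Bregman1973, Thm 1] -/
theorem log_card_mul_card_le_bregman_quot {S T U : Finset (Equiv.Perm (Fin n))}
    (h : TripleProductProperty S T U) (hS : S.Nonempty) (hT : T.Nonempty) (hU : U.Nonempty) :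
    Real.log (S.card : ℝ) + Real.log (T.card : ℝ) ≤
      ∑ i : Fin n, Real.log ((((Finset.image₂ (fun s t => s⁻¹ * t) S T).image (fun σ => σ i)).card).factorial : ℝ) /
        (((Finset.image₂ (fun s t => s⁻¹ * t) S T).image (fun σ => σ i)).card : ℝ) := by
  have hcard : (Finset.image₂ (fun s t => s⁻¹ * t) S T).card = S.card * T.card :=
    stub_quotientCard n S T (pairInj_of_tpp' h hU)
  have hq : (Finset.image₂ (fun s t => s⁻¹ * t) S T).Nonempty := by
    rw [← Finset.card_pos, hcard]
    exact Nat.mul_pos hS.card_pos hT.card_pos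
  have hB := stub_bregmanMinc n _ hq
  have hSpos : (0 : ℝ) < S.card := by exact_mod_cast hS.card_pos
  have hTpos : (0 : ℝ) < T.card := by exact_mod_cast hT.card_pos
  rw [hcard, Nat.cast_mul, Real.log_mul hSpos.ne' hTpos.ne'] at hB
  exact hB

/-- **Volume against the quotient's Brégman bound.**  For a TPP triple of non-empty sets,
`2·(log #S + log #T + log #U) ≤ 2·log n! + ∑_i log(r_i!)/r_i` with `r_i` the row supports of `S⁻¹T`
(Brégman for the quotient set plus the packing bounds `#T#U, #U#S ≤ n!`). [cite: Bregman1973, Thm 1] -/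
theorem two_mul_log_volume_le_of_tpp {S T U : Finset (Equiv.Perm (Fin n))}
    (h : TripleProductProperty S T U) (hS : S.Nonempty) (hT : T.Nonempty) (hU : U.Nonempty) :
    2 * (Real.log (S.card : ℝ) + Real.log (T.card : ℝ) + Real.log (U.card : ℝ)) ≤
      2 * Real.log (n.factorial : ℝ) +
        ∑ i : Fin n, Real.log ((((Finset.image₂ (fun s t => s⁻¹ * t) S T).image (fun σ => σ i)).card).factorial : ℝ) /
          (((Finset.image₂ (fun s t => s⁻¹ * t) S T).image (fun σ => σ i)).card : ℝ) := by
  have hq := log_card_mul_card_le_bregman_quot h hS hT hU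
  have lTU := log_card_add_log_card_le_log_factorial h.rotate hT hU hS
  have lUS := log_card_add_log_card_le_log_factorial h.rotate.rotate hU hS hT
  linarith

/-- **Volume against one set's Brégman bound.**  For a TPP triple of non-empty sets,
`log #S + log #T + log #U ≤ log n! + ∑_i log(r_i!)/r_i` with `r_i = #{σ i : σ ∈ S}` the row supports of `S`
(Brégman for `S` plus the packing bound `#T#U ≤ n!`). [cite: Bregman1973, Thm 1] -/
theorem log_volume_le_of_tpp_of_bregman_set {S T U : Finset (Equiv.Perm (Fin n))}
    (h : TripleProductProperty S T U) (hS : S.Nonempty) (hT : T.Nonempty) (hU : U.Nonempty) :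
    Real.log (S.card : ℝ) + Real.log (T.card : ℝ) + Real.log (U.card : ℝ) ≤
      Real.log (n.factorial : ℝ) +
        ∑ i : Fin n, Real.log (((S.image (fun σ => σ i)).card).factorial : ℝ) /
          ((S.image (fun σ => σ i)).card : ℝ) := by
  have hB := stub_bregmanMinc n S hS
  have lTU := log_card_add_log_card_le_log_factorial h.rotate hT hU hS
  linarith

/-- From a logarithmic volume bound to the `(n!)^{3/2} e^{-c√n}` form. [folklore] -/
theorem volume_le_of_log_le {S T U : Finset (Equiv.Perm (Fin n))} (hS : S.Nonempty) (hT : T.Nonempty)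
    (hU : U.Nonempty) {c : ℝ}
    (h : Real.log (S.card : ℝ) + Real.log (T.card : ℝ) + Real.log (U.card : ℝ) ≤
      3 / 2 * Real.log (n.factorial : ℝ) - c * Real.sqrt (n : ℝ)) :
    ((S.card * T.card * U.card : ℕ) : ℝ) ≤
      (n.factorial : ℝ) ^ ((3 : ℝ) / 2) * Real.exp (-(c * Real.sqrt (n : ℝ))) := by
  have hF : (0 : ℝ) < (n.factorial : ℝ) := by exact_mod_cast n.factorial_pos
  have hSpos : (0 : ℝ) < S.card := by exact_mod_cast hS.card_pos
  have hTpos : (0 : ℝ) < T.card := by exact_mod_cast hT.card_pos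
  have hUpos : (0 : ℝ) < U.card := by exact_mod_cast hU.card_pos
  have hbound : (0 : ℝ) < (n.factorial : ℝ) ^ ((3 : ℝ) / 2) * Real.exp (-(c * Real.sqrt (n : ℝ))) := by
    positivity
  have hV : ((S.card * T.card * U.card : ℕ) : ℝ) = (S.card : ℝ) * T.card * U.card := by push_cast; ring
  have hVpos : (0 : ℝ) < (S.card : ℝ) * T.card * U.card := by positivity
  have hlogV : Real.log ((S.card : ℝ) * T.card * U.card) =
      Real.log S.card + Real.log T.card + Real.log U.card := by
    rw [Real.log_mul (by positivity) hUpos.ne', Real.log_mul hSpos.ne' hTpos.ne']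
  have hlogB : Real.log ((n.factorial : ℝ) ^ ((3 : ℝ) / 2) * Real.exp (-(c * Real.sqrt (n : ℝ)))) =
      3 / 2 * Real.log n.factorial - c * Real.sqrt n := by
    rw [Real.log_mul (Real.rpow_pos_of_pos hF _).ne' (Real.exp_pos _).ne', Real.log_rpow hF,
      Real.log_exp]; ring
  rw [hV, ← Real.log_le_log_iff hVpos hbound, hlogB, hlogV]
  exact h

/-- **The class-pruning theorem of the line (thin quotient set).**  If `(S, T, U)` is a TPP triple in `S_n`
and the Brégman bound of the quotient set `S⁻¹T` is at most `log n! − 2c√n` — i.e. its row supports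
`r_i = #{a i : a ∈ S⁻¹T}` are thin enough that `∑_i log(r_i!)/r_i ≤ log n! − 2c√n` — then the triple is
sub-threshold: `#S #T #U ≤ (n!)^{3/2} e^{−c√n}`.  Valid for every real `c` and every `n`; the bump-free hypothesis
of the crux `GlobalBranch` is not needed on this class.  (Apply to `h.rotate`, `h.rotate.rotate` for the quotient
sets `T⁻¹U`, `U⁻¹S`.) [cite: Bregman1973, Thm 1] -/
theorem thinQuotient_subthreshold : ∀ (n : ℕ) (S T U : Finset (Equiv.Perm (Fin n))),
    TripleProductProperty S T U → ∀ c : ℝ,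
      ∑ i : Fin n,
          Real.log ((((Finset.image₂ (fun s t => s⁻¹ * t) S T).image (fun σ => σ i)).card).factorial : ℝ) /
            (((Finset.image₂ (fun s t => s⁻¹ * t) S T).image (fun σ => σ i)).card : ℝ) ≤
        Real.log (n.factorial : ℝ) - 2 * c * Real.sqrt (n : ℝ) →
      ((S.card * T.card * U.card : ℕ) : ℝ) ≤
        (n.factorial : ℝ) ^ ((3 : ℝ) / 2) * Real.exp (-(c * Real.sqrt (n : ℝ))) := by
  intro n S T U h c hthin
  have hbound : (0 : ℝ) ≤ (n.factorial : ℝ) ^ ((3 : ℝ) / 2) * Real.exp (-(c * Real.sqrt (n : ℝ))) := by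
    positivity
  rcases S.eq_empty_or_nonempty with hS | hS
  · simp [hS, hbound]
  rcases T.eq_empty_or_nonempty with hT | hT
  · simp [hT, hbound]
  rcases U.eq_empty_or_nonempty with hU | hU
  · simp [hU, hbound]
  have h2 := two_mul_log_volume_le_of_tpp h hS hT hU
  exact volume_le_of_log_le hS hT hU (by linarith)

/-- **The class-pruning theorem of the line (support-thin set).**  If `(S, T, U)` is a TPP triple in `S_n` and
the Brégman bound of `S` itself is at most `½ log n! − c√n` (`∑_i log(r_i!)/r_i` over the row supports of `S`),
then `#S #T #U ≤ (n!)^{3/2} e^{−c√n}`.  (Rotate for `T`, `U`.) [cite: Bregman1973, Thm 1] -/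
theorem thinSet_subthreshold : ∀ (n : ℕ) (S T U : Finset (Equiv.Perm (Fin n))),
    TripleProductProperty S T U → ∀ c : ℝ,
      ∑ i : Fin n, Real.log (((S.image (fun σ => σ i)).card).factorial : ℝ) /
          ((S.image (fun σ => σ i)).card : ℝ) ≤
        Real.log (n.factorial : ℝ) / 2 - c * Real.sqrt (n : ℝ) →
      ((S.card * T.card * U.card : ℕ) : ℝ) ≤
        (n.factorial : ℝ) ^ ((3 : ℝ) / 2) * Real.exp (-(c * Real.sqrt (n : ℝ))) := by
  intro n S T U h c hthin
  have hbound : (0 : ℝ) ≤ (n.factorial : ℝ) ^ ((3 : ℝ) / 2) * Real.exp (-(c * Real.sqrt (n : ℝ))) := by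
    positivity
  rcases S.eq_empty_or_nonempty with hS | hS
  · simp [hS, hbound]
  rcases T.eq_empty_or_nonempty with hT | hT
  · simp [hT, hbound]
  rcases U.eq_empty_or_nonempty with hU | hU
  · simp [hU, hbound]
  have h1 := log_volume_le_of_tpp_of_bregman_set h hS hT hU
  exact volume_le_of_log_le hS hT hU (by linarith)

end Summit.MatrixMultiplication.MatrixMultiplication.Theorems.GlobalBranch
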